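import Mathlib
import Summits.Ventures.LatticeQCDFlow.Scaling.U1PlaquetteLayer
import Summits.Ventures.LatticeQCDFlow.Scaling.SlabKernel

/-!
# LatticeQCDFlow / Scaling — the torus as a slab chain: reading the `U(1)` torus configuration by
# height along an axis, measure-preservingly, with the plaquette sum as a slab-chain cost

HONEST FRAMING: exact (Metropolis-corrected) sampling algorithms for lattice gauge theory;
figures of merit are autocorrelation/cost numbers at stated couplings and volumes; no
continuum-physics claim.

Venture `LatticeQCDFlow` (cell pub-lqcd), topic `Scaling`, FANOUT row 30 (lean-1) — OUR WORK (LEAD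
LINE 230 (G3′)), lattice file 6 of the slab-chain proof of (LC) at every separation: the
DICTIONARY between the torus `(ℤ/L)^d`, `L = n+1`, with its bond variables
`W : GaugeConfig d L U(1)`, and the abstract slab chain of `Scaling/SlabKernel.lean`.  Heights are
read along the axis `a` with the sign reversed (`toF (−x_a)`), so that the plaquette translated
by `−t e_a` sits at height `t`:
* `toZ`, `toF` — the identification `Fin (n+1) ≃ ℤ/(n+1)` by values; `edgeEquiv` — every torus bond
  is either a horizontal bond `(h, ℓ)` of the layer at height `h` or a vertical bond `(h, y)` of the
  slab `h` (`Edge d L ≃ (Fin L × LEdge) ⊕ (Fin L × LSite)`);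
* `layerCfg`, `vertCfg`, `heightCfg` — the layer and vertical variables of a configuration;
  **`measurePreserving_heightCfg`** — under the Haar product on the bonds they are distributed as
  the product of Haar products required by the slab chain (reindexing, `sumPiEquivProdPi`, and
  currying of finite products, `Measure.infinitePi_map_curry`);
* `update_shift_of_ne`, `update_shift_self`, `layerCfg_tgt` — the bookkeeping identities that read
  a torus plaquette holonomy in slab coordinates: a lateral plaquette `(x; a, b)` of slab `h` has
  holonomy `plaqU (layerCfg h) (vertCfg h) (layerCfg (h+1)) ℓ` (`plaquetteHolonomy_lateral`, and the
  reversed label the inverse, `plaquetteHolonomy_lateral_rev`), and a horizontal plaquette of the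
  layer `h` is a product of four `layerCfg h` variables (`plaquetteHolonomy_horizontal`).
The sequel `Scaling/TorusSlabCost.lean` sums these into the slab-chain cost, and
`Scaling/U1CrossCutFloorAllT.lean` assembles (LC) at every separation.  Elementary; nothing is cited
as a fact; `def`s `toZ`, `toF`, `baseSite`, `edgeEquiv`, `layerCfg`, `vertCfg`, `heightCfg`;
no `sorry`.
-/

noncomputable section

open MeasureTheory Filter Finset
open Literature.MathematicalPhysics.QuantumFieldTheory
open Summit.Ventures.LatticeQCDFlow.Theory2.Lattice.U1Torus (holT cosT)

namespace Summit.Ventures.LatticeQCDFlow.Theory2.Lattice.U1Layer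

variable {d n : ℕ} {a : Fin d}

/-! ## 1. Heights and the bond dictionary -/

/-- A height as a residue. [folklore] -/
def toZ (h : Fin (n + 1)) : ZMod (n + 1) := (h.val : ZMod (n + 1))

/-- A residue as a height. [folklore] -/
def toF (z : ZMod (n + 1)) : Fin (n + 1) := ⟨z.val, ZMod.val_lt z⟩

/-- `toZ (toF z) = z`. [folklore] -/
@[simp] theorem toZ_toF (z : ZMod (n + 1)) : toZ (toF z) = z := by
  simp [toZ, toF]

/-- `toF (toZ h) = h`. [folklore] -/
@[simp] theorem toF_toZ (h : Fin (n + 1)) : toF (toZ h) = h := by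
  apply Fin.ext
  simp [toZ, toF, ZMod.val_natCast, Nat.mod_eq_of_lt h.isLt]

/-- `toZ (h + 1) = toZ h + 1`. [folklore] -/
theorem toZ_add_one (h : Fin (n + 1)) : toZ (h + 1) = toZ h + 1 := by
  simp only [toZ, Fin.val_add]
  rw [ZMod.natCast_mod, Nat.cast_add, Fin.val_one', ZMod.natCast_mod, Nat.cast_one]

/-- `toZ 0 = 0`. [folklore] -/
@[simp] theorem toZ_zero : toZ (0 : Fin (n + 1)) = 0 := by simp [toZ]

/-- The base point of a site in the layer: its `a`-coordinate set to `0`. [folklore] -/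
def baseSite (a : Fin d) (x : Site d (n + 1)) : LSite d (n + 1) a :=
  ⟨Function.update x a 0, by simp⟩

/-- Resetting the `a`-coordinate of a layer site after changing it gives the site back. [folklore] -/
theorem update_update_base (y : LSite d (n + 1) a) (c : ZMod (n + 1)) :
    Function.update (Function.update y.1 a c) a 0 = y.1 := by
  rw [Function.update_idem]
  exact Function.update_eq_self_iff.2 y.2.symm

/-- **The bond dictionary**: a torus bond is a horizontal bond of a layer or a vertical bond of a
slab; heights are read with the sign reversed. [folklore] -/
def edgeEquiv (a : Fin d) :
    Edge d (n + 1) ≃ (Fin (n + 1) × LEdge d (n + 1) a) ⊕ (Fin (n + 1) × LSite d (n + 1) a) where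
  toFun e := if hb : e.2 = a then Sum.inr (toF (-(e.1 a) - 1), baseSite a e.1)
    else Sum.inl (toF (-(e.1 a)), ⟨(baseSite a e.1, e.2), hb⟩)
  invFun s := match s with
    | Sum.inl p => (Function.update p.2.src.1 a (-(toZ p.1)), p.2.dir)
    | Sum.inr p => (Function.update p.2.1 a (-(toZ p.1) - 1), a)
  left_inv e := by
    rcases e with ⟨x, b⟩
    by_cases hb : b = a
    · subst hb
      dsimp only
      rw [dif_pos rfl]
      refine Prod.ext ?_ rfl
      show Function.update (Function.update x b 0) b (-(toZ (toF (-(x b) - 1))) - 1) = x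
      rw [toZ_toF, Function.update_idem, show -(-(x b) - 1) - 1 = x b by ring,
        Function.update_eq_self]
    · dsimp only
      rw [dif_neg hb]
      refine Prod.ext ?_ rfl
      show Function.update (Function.update x a 0) a (-(toZ (toF (-(x a))))) = x
      rw [toZ_toF, Function.update_idem, neg_neg, Function.update_eq_self]
  right_inv s := by
    rcases s with ⟨h, ℓ⟩ | ⟨h, y⟩
    · dsimp only
      rw [dif_neg ℓ.dir_ne]
      congr 1
      refine Prod.ext ?_ (LEdge.ext_of_src_dir (Subtype.ext (update_update_base ℓ.src _)) rfl)
      show toF (-(Function.update ℓ.src.1 a (-(toZ h)) a)) = h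
      rw [Function.update_self, neg_neg, toF_toZ]
    · dsimp only
      rw [dif_pos rfl]
      congr 1
      refine Prod.ext ?_ (Subtype.ext (update_update_base y _))
      show toF (-(Function.update y.1 a (-(toZ h) - 1) a) - 1) = h
      rw [Function.update_self, show -(-toZ h - 1) - 1 = toZ h by ring, toF_toZ]

/-! ## 2. The configuration read by heights, and its law -/

/-- The horizontal bond variables of the layer at height `h`. [folklore] -/
def layerCfg (a : Fin d) (W : GaugeConfig d (n + 1) Circle) (h : Fin (n + 1)) :
    LEdge d (n + 1) a → Circle :=
  fun ℓ => W (Function.update ℓ.src.1 a (-(toZ h)), ℓ.dir)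

/-- The vertical bond variables of the slab `h`. [folklore] -/
def vertCfg (a : Fin d) (W : GaugeConfig d (n + 1) Circle) (h : Fin (n + 1)) :
    LSite d (n + 1) a → Circle :=
  fun y => W (Function.update y.1 a (-(toZ h) - 1), a)

/-- **The configuration read by heights**: layers and vertical variables. [folklore] -/
def heightCfg (a : Fin d) (W : GaugeConfig d (n + 1) Circle) :
    (Fin (n + 1) → LEdge d (n + 1) a → Circle) × (Fin (n + 1) → LSite d (n + 1) a → Circle) :=
  (layerCfg a W, vertCfg a W)

/-- Reindexing a finite Haar product along a bijection of the index set preserves it. [folklore] -/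
theorem measurePreserving_reindex {ι ι' X : Type*} [Fintype ι] [Fintype ι'] [MeasurableSpace X]
    (μ : Measure X) [SigmaFinite μ] (Θ : ι ≃ ι') :
    MeasurePreserving (fun (W : ι → X) (b : ι') => W (Θ.symm b)) (Measure.pi fun _ => μ)
      (Measure.pi fun _ => μ) := by
  have hm : Measurable (fun (W : ι → X) (b : ι') => W (Θ.symm b)) :=
    measurable_pi_lambda _ fun b => measurable_pi_apply (Θ.symm b)
  refine ⟨hm, ?_⟩
  refine (Measure.pi_eq fun s hs => ?_).symm
  rw [Measure.map_apply hm (MeasurableSet.univ_pi hs)]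
  have hpre : (fun (W : ι → X) (b : ι') => W (Θ.symm b)) ⁻¹' Set.pi Set.univ s =
      Set.pi Set.univ fun e => s (Θ e) := by
    ext W
    simp only [Set.mem_preimage, Set.mem_pi, Set.mem_univ, forall_const]
    constructor
    · intro hW e; simpa using hW (Θ e)
    · intro hW b; simpa using hW (Θ.symm b)
  rw [hpre, Measure.pi_pi]
  exact Θ.prod_comp fun b => μ (s b)

/-- **The law of the configuration read by heights** is the product of Haar products required by
the slab chain. [folklore] -/
theorem measurePreserving_heightCfg (a : Fin d) :
    MeasurePreserving (heightCfg (n := n) a) (Measure.pi fun _ : Edge d (n + 1) => haarProbability Circle)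
      ((Measure.pi fun _ : Fin (n + 1) =>
          Measure.pi fun _ : LEdge d (n + 1) a => haarProbability Circle).prod
        (Measure.pi fun _ : Fin (n + 1) =>
          Measure.pi fun _ : LSite d (n + 1) a => haarProbability Circle)) := by
  have h1 := measurePreserving_reindex (haarProbability Circle) (edgeEquiv (n := n) a)
  have h2 := measurePreserving_sumPiEquivProdPi (fun _ : (Fin (n + 1) × LEdge d (n + 1) a) ⊕
    (Fin (n + 1) × LSite d (n + 1) a) => haarProbability Circle)
  -- currying a finite product of probability measures preserves it (`Measure.infinitePi_map_curry`)
  have hc : ∀ (κ : Type) [Fintype κ], MeasurePreserving (MeasurableEquiv.curry (Fin (n + 1)) κ Circle)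
      (Measure.pi fun _ : Fin (n + 1) × κ => haarProbability Circle)
      (Measure.pi fun _ : Fin (n + 1) => Measure.pi fun _ : κ => haarProbability Circle) := by
    intro κ _
    refine ⟨(MeasurableEquiv.curry (Fin (n + 1)) κ Circle).measurable, ?_⟩
    have h := Measure.infinitePi_map_curry (fun (_ : Fin (n + 1)) (_ : κ) => haarProbability Circle)
    simp only [Measure.infinitePi_eq_pi] at h
    exact h
  have h3 := (hc (LEdge d (n + 1) a)).prod (hc (LSite d (n + 1) a))
  have h := h3.comp (h2.comp h1)
  have hfun : heightCfg (n := n) a =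
      (Prod.map (MeasurableEquiv.curry (Fin (n + 1)) (LEdge d (n + 1) a) Circle)
        (MeasurableEquiv.curry (Fin (n + 1)) (LSite d (n + 1) a) Circle)) ∘
      ((MeasurableEquiv.sumPiEquivProdPi fun _ : (Fin (n + 1) × LEdge d (n + 1) a) ⊕
          (Fin (n + 1) × LSite d (n + 1) a) => Circle) ∘
        fun (W : Edge d (n + 1) → Circle) b => W ((edgeEquiv a).symm b)) := by
    funext W
    rfl
  rw [hfun]
  exact h

/-! ## 3. Plaquette holonomies in slab coordinates -/

/-- Shifting in a direction `k ≠ a` commutes with resetting the `a`-coordinate. [folklore] -/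
theorem update_shift_of_ne (y : Site d (n + 1)) (c : ZMod (n + 1)) {k : Fin d} (hk : k ≠ a) :
    Site.shift (Function.update y a c) k = Function.update (y.shift k) a c := by
  funext m
  by_cases hm : m = a
  · subst hm; simp [Site.shift, hk.symm]
  · simp [Site.shift, hm]

/-- Shifting along the axis raises the `a`-coordinate by one. [folklore] -/
theorem update_shift_self (y : Site d (n + 1)) (c : ZMod (n + 1)) :
    Site.shift (Function.update y a c) a = Function.update y a (c + 1) := by
  funext m
  by_cases hm : m = a
  · subst hm; simp [Site.shift]
  · simp [Site.shift, hm]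

/-- The layer variable at the target of a layer edge. [folklore] -/
theorem layerCfg_tgt (W : GaugeConfig d (n + 1) Circle) (h : Fin (n + 1)) (y : LSite d (n + 1) a)
    {k l : Fin d} (hk : k ≠ a) (hl : l ≠ a) :
    layerCfg a W h ⟨(LEdge.tgt ⟨(y, k), hk⟩, l), hl⟩ =
      W (Site.shift (Function.update y.1 a (-(toZ h))) k, l) := by
  simp only [layerCfg, LEdge.src, LEdge.dir, LEdge.tgt, update_shift_of_ne _ _ hk]

/-- **A horizontal plaquette read in layer coordinates.** For `k, l ≠ a` and the site
`x = update y a (−h)` of the layer at height `h`: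
`U_{(x;k,l)}(W) = e(y,k) e(y+e_k,l) e(y+e_l,k)⁻¹ e(y,l)⁻¹` with `e = layerCfg h`. [folklore] -/
theorem plaquetteHolonomy_horizontal (W : GaugeConfig d (n + 1) Circle) (h : Fin (n + 1))
    (y : LSite d (n + 1) a) {k l : Fin d} (hk : k ≠ a) (hl : l ≠ a) :
    plaquetteHolonomy W (Function.update y.1 a (-(toZ h))) k l =
      layerCfg a W h ⟨(y, k), hk⟩ * layerCfg a W h ⟨(LEdge.tgt ⟨(y, k), hk⟩, l), hl⟩ *
        (layerCfg a W h ⟨(LEdge.tgt ⟨(y, l), hl⟩, k), hk⟩)⁻¹ * (layerCfg a W h ⟨(y, l), hl⟩)⁻¹ := by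
  rw [layerCfg_tgt W h y hk hl, layerCfg_tgt W h y hl hk]
  simp only [plaquetteHolonomy, layerCfg, LEdge.src, LEdge.dir]

/-- **A lateral plaquette read in slab coordinates.** For `b ≠ a` and the site
`x = update y a (−h−1)` (slab `h`): `U_{(x;a,b)}(W) = plaqU (layerCfg h) (vertCfg h) (layerCfg (h+1)) ℓ`
with `ℓ = (y, b)`. [folklore] -/
theorem plaquetteHolonomy_lateral (W : GaugeConfig d (n + 1) Circle) (h : Fin (n + 1))
    (y : LSite d (n + 1) a) {b : Fin d} (hb : b ≠ a) :
    plaquetteHolonomy W (Function.update y.1 a (-(toZ h) - 1)) a b =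
      plaqU (layerCfg a W h) (vertCfg a W h) (layerCfg a W (h + 1)) ⟨(y, b), hb⟩ := by
  simp only [plaquetteHolonomy, plaqU, layerCfg, vertCfg, LEdge.src, LEdge.dir, LEdge.tgt,
    update_shift_self, update_shift_of_ne _ _ hb, toZ_add_one, neg_add, sub_add_cancel,
    ← sub_eq_add_neg]

/-- The reversed lateral label `(x; b, a)` (`b < a`) has the inverse holonomy. [folklore] -/
theorem plaquetteHolonomy_lateral_rev (W : GaugeConfig d (n + 1) Circle) (h : Fin (n + 1))
    (y : LSite d (n + 1) a) {b : Fin d} (hb : b ≠ a) :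
    plaquetteHolonomy W (Function.update y.1 a (-(toZ h) - 1)) b a =
      (plaqU (layerCfg a W h) (vertCfg a W h) (layerCfg a W (h + 1)) ⟨(y, b), hb⟩)⁻¹ := by
  rw [← plaquetteHolonomy_lateral W h y hb]
  simp only [plaquetteHolonomy, mul_inv_rev, inv_inv, mul_assoc]

end Summit.Ventures.LatticeQCDFlow.Theory2.Lattice.U1Layer

end
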